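import Literature.NumberTheory.EllipticCurves.KodairaNeronUnramifiedInertiaProofs
import Literature.NumberTheory.EllipticCurves.GaloisConjugateReductionLayerProofs
import Literature.NumberTheory.EllipticCurves.ReductionInertiaInvarianceProofs
import Literature.NumberTheory.EllipticCurves.GeomPointReduction
import Literature.NumberTheory.EllipticCurves.KummerSelmerStructure
import HarnessLib

/-!
# LP-A: the good-reduction map over `\bar K_w` at a place `w` of a number field, the INERTIA-STRICT
# condition on local classes of `E[n]`, and: KUMMER CLASSES ARE STRICT (cell `b2b-bsdres`, unit
# `b2b-bsdres-eisenstein-p1`, gen 20; X1R0-GAPMAP §28.4 (LP-A), §29)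

HONEST FRAMING (run/shared/lean/b2b/bsd-rank1-residual/, verbatim in every file): the goal of the
cell is to DELETE the COMBINATION-SHAPED residual classes of the Birch–Swinnerton-Dyer formula for
ALL analytic-rank `≤ 1` elliptic curves over `ℚ` — "full BSD formula for every rank `≤ 1` curve in
class `C`" assembled STRICTLY from published theorems — so that the rank-`≤ 1` remainder becomes
exactly the CONSTRUCTION-SHAPED classes, which are TYPED (missing-input `Prop`s), NOT attempted.
This is not "finishing BSD". Sub-cell `b2b-bsdres-eisenstein-p1`: research route; NO CLAIM BEYOND
STATED CLASSES; nothing here changes a label; nothing is booked. THEOREMS ONLY — no definition, no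
named fact; `K`-general (any number field `K`, any elliptic `V/K`, any finite place `w`), the
reduction map is a HYPOTHESIS-SHAPED datum (`red`, `hred`: the tree's `reducePoint` of an
`𝒪_w`-model `M` with `M ⊗ \bar K_w = V ⊗ \bar K_w`, as in `OrdinaryLocalReductionMapProofs`).

## What and why

The local package at the prime `wp` of `K_n = ℚ_n` above `p` (what is left of route M's local term
after `X1/GeneratorCountLayerAtPStrict`, memo `V76-LOCAL-TERM-PLAN.md` §5.2) is a subgroup
`𝓛 ⊇ 𝓚` of `H¹(K_{n,wp}, E[p])` of index `≥ p²` over `𝓚` all of whose classes are STRICT: every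
cocycle `ψ` of the class has `red(ψ(g)) = Õ` for all `g` in the local inertia group restricting into
`Gal(\bar K_n/K_{n,∞})`. This file supplies, `K`-generally (FILE 6–9 import context, no `ℚ`-side
objects), the reduction side:

* §1 `exists_red`, `red_smul_eq_zero_iff` (the kernel of reduction is `Γ_{K_w}`-stable: `σ` is an
  isometry of `|·|_w`), **`red_smul_of_mem_absInertia`** (the INERTIA group does not change
  reductions — tree `reducePoint_congrEquiv_smul_eq_of_val`, `inertia_eq_absInertia`);
* §2 for continuous cocycles `ψ : Γ_{K_w} → E[n](\bar K)` of the local module: the strict values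
  `g ↦ red(ψ(g))` are ADDITIVE on inertia (`red_cocycle_mul_of_mem_absInertia`) and the condition
  "`red(ψ(g)) = Õ` on `I ∩ res⁻¹(H')`" depends only on the CLASS of `ψ`
  (`forall_red_cocycle_eq_zero_iff_of_oneCocycleClass_eq`: coboundaries `g ↦ gQ − Q` have
  `red(gQ − Q) = Õ` for inertial `g`);
* §3 **`forall_red_cocycle_eq_zero_of_mem_kummerLocalConditionAt`**: every cocycle of a class in
  the local KUMMER condition `𝓚_w = ker(H¹(K_w, E[n]) → H¹(K_w, E))` is strict on the whole inertia
  group (`ψ(g) = gR − R` in `E(\bar K_w)`), i.e. `𝓚 ≤ 𝓛` for the package.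

References: [SilvermanAEC2009] VII.§2 Prop. VII.2.1, VIII.§1, X.§4; [NeukirchANT1999] II (9.3);
[GreenbergLNM1716] §2 pp. 70–75 (the local condition at `p` along the cyclotomic tower).
-/

noncomputable section

open scoped Classical NNReal

open Function Field NumberField IsDedekindDomain WeierstrassCurve
  Literature.NumberTheory.EllipticCurves Literature.NumberTheory.GaloisRepresentations
  IsDedekindDomain.HeightOneSpectrum

set_option autoImplicit false

namespace Summit.BirchSwinnertonDyer.Rank1Residual.X1.LocalReductionStrict

-- `K : Type` (universe 0), as FILES 6–9 / 23–24c.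
variable {K : Type} [Field K] [NumberField K] (V : WeierstrassCurve K) (n : ℤ)
  (wp : HeightOneSpectrum (𝓞 K))
  {w : Valuation (AlgebraicClosure (wp.adicCompletion K)) ℝ≥0}
  (hw : ∀ x, (w x : ℝ) =
    spectralNorm (wp.adicCompletion K) (AlgebraicClosure (wp.adicCompletion K)) x)
  {M : WeierstrassCurve ↥w.valuationSubring}
  (hMK : M.baseChange (AlgebraicClosure (wp.adicCompletion K)) =
    V.baseChange (AlgebraicClosure (wp.adicCompletion K)))
  {red : localPoints V (wp.adicCompletion K) →+
    (M.map (IsLocalRing.residue ↥w.valuationSubring)).toAffine.Point}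
  (hred : ∀ P, red P = M.reducePoint (Affine.Point.congrEquiv hMK.symm P))

/-! ## §1. The reduction map `red : E(\bar K_w) →+ Ẽ(\bar k_w)` and the local Galois action -/

/-- **The good-reduction homomorphism** of an `𝒪_w`-model `M` of `V ⊗ \bar K_w` with unit
discriminant, on the local points `E(\bar K_w)` (tree `goodReductionHom`, Silverman VII.2.1),
packaged in the hypothesis shape `(red, hred)` used below. [cite: SilvermanAEC2009, Prop. VII.2.1] -/
theorem exists_red (hΔ : IsUnit M.Δ) :
    ∃ red : localPoints V (wp.adicCompletion K) →+
      (M.map (IsLocalRing.residue ↥w.valuationSubring)).toAffine.Point,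
      ∀ P, red P = M.reducePoint (Affine.Point.congrEquiv hMK.symm P) :=
  ⟨(goodReductionHom M (Valuation.valuationSubring.integers w) hΔ).comp
      (Affine.Point.congrEquiv hMK.symm).toAddMonoidHom, fun _ ↦ rfl⟩

include hw hred in
/-- **`ker red` is `Γ_{K_w}`-stable**: `red (σP) = Õ ↔ red P = Õ` (`σ` is a `|·|_w`-isometry; tree
`reducesToZero_congrEquiv_map_iff`). [cite: SilvermanAEC2009, VII.§2] -/
theorem red_smul_eq_zero_iff (hΔ : IsUnit M.Δ) (σ : absoluteGaloisGroup (wp.adicCompletion K))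
    (P : localPoints V (wp.adicCompletion K)) : red (σ • P) = 0 ↔ red P = 0 := by
  have hvO : w.Integers w.valuationSubring := Valuation.valuationSubring.integers w
  rw [hred, hred, ← goodReductionHom_apply hvO hΔ, ← goodReductionHom_apply hvO hΔ,
    goodReductionHom_eq_zero_iff, goodReductionHom_eq_zero_iff, localPoints.smul_def]
  exact reducesToZero_congrEquiv_map_iff _ hMK.symm _ (fun z ↦ spectralValuation_smul hw σ z) _

include hw hred in
/-- **The local INERTIA group does not change the reduction: `red (σP) = red P` for
`σ ∈ absInertia K_w`** (`σ` moves `|·|_w`-integers within their residue class —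
`mem_inertia_iff_spectralValuation`, `inertia_eq_absInertia` — so the integral coordinates of `P`
keep their residues, `reducePoint_congrEquiv_smul_eq_of_val`).
[cite: SilvermanAEC2009, VIII.§1 and VII.§2] [cite: NeukirchANT1999, Ch. II (9.3)] -/
theorem red_smul_of_mem_absInertia {σ : absoluteGaloisGroup (wp.adicCompletion K)}
    (hσ : σ ∈ absInertia (wp.adicCompletion K)) (P : localPoints V (wp.adicCompletion K)) :
    red (σ • P) = red P := by
  obtain ⟨𝔐, h𝔐⟩ := wp.localPrimesAbove_nonempty
  have hσ' : σ ∈ 𝔐.inertia (absoluteGaloisGroup (wp.adicCompletion K)) := by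
    rw [inertia_eq_absInertia hw h𝔐]; exact hσ
  have hmove := (mem_inertia_iff_spectralValuation hw h𝔐).1 hσ'
  rw [hred, hred]
  exact reducePoint_congrEquiv_smul_eq_of_val hw hMK σ P (fun x y _ _ ↦ ⟨hmove x, hmove y⟩)

include hw hred in
/-- `red (σP − P) = Õ` for `σ` in the inertia group. [cite: SilvermanAEC2009, VIII.§1] -/
theorem red_smul_sub_self_of_mem_absInertia {σ : absoluteGaloisGroup (wp.adicCompletion K)}
    (hσ : σ ∈ absInertia (wp.adicCompletion K)) (P : localPoints V (wp.adicCompletion K)) :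
    red (σ • P - P) = 0 := by
  rw [map_sub, red_smul_of_mem_absInertia V wp hw hMK hred hσ P, sub_self]

/-! ## §2. Strict values of continuous cocycles of the local module `E[n](\bar K)|_{Γ_{K_w}}` -/

/-- The map on points intertwines the local module's action (through `absGaloisRestrict`) with the
action of `Γ_{K_w}` on `E(\bar K_w)`: `pointsMap (ρ(g) Q) = g • pointsMap Q`. [folklore] -/
theorem pointsMap_rho_apply (g : absoluteGaloisGroup (wp.adicCompletion K)) (Q : geomTorsion V n) :
    pointsMap V (wp.adicCompletion K)
        (((DiscreteGaloisModule.toTopRep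
          (GaloisRep.restrictField (wp.adicCompletion K) (V.torsionGaloisModule n))).ρ g Q :
            geomTorsion V n) : geomPoints V) =
      g • pointsMap V (wp.adicCompletion K) ((Q : geomTorsion V n) : geomPoints V) := by
  change pointsMap V (wp.adicCompletion K)
      (((absGaloisRestrict K (wp.adicCompletion K) g • Q : geomTorsion V n)) : geomPoints V) = _
  rw [Literature.NumberTheory.EllipticCurves.AddSubgroup.torsionBy.coe_smul,
    ← resGal_eq_absGaloisRestrict, pointsMap_smul]

include hw hred in
/-- **Strict values are additive on inertia**: for a continuous cocycle `ψ` of the local module and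
`g ∈ absInertia K_w`, `red(ψ(gh)) = red(ψ(g)) + red(ψ(h))` (cocycle identity, equivariance of the
map on points, and `red (gQ) = red Q`). [cite: SilvermanAEC2009, VIII.§1] -/
theorem red_cocycle_mul_of_mem_absInertia
    (ψ : contOneCocycles (DiscreteGaloisModule.toTopRep
      (GaloisRep.restrictField (wp.adicCompletion K) (V.torsionGaloisModule n))))
    {g : absoluteGaloisGroup (wp.adicCompletion K)} (hg : g ∈ absInertia (wp.adicCompletion K))
    (h : absoluteGaloisGroup (wp.adicCompletion K)) :
    red (pointsMap V (wp.adicCompletion K) ((ψ.1 (g * h) : geomTorsion V n) : geomPoints V)) =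
      red (pointsMap V (wp.adicCompletion K) ((ψ.1 g : geomTorsion V n) : geomPoints V)) +
        red (pointsMap V (wp.adicCompletion K) ((ψ.1 h : geomTorsion V n) : geomPoints V)) := by
  rw [ψ.2 g h, AddSubgroup.coe_add, map_add, map_add, pointsMap_rho_apply,
    red_smul_of_mem_absInertia V wp hw hMK hred hg]

include hw hred in
/-- **The strict condition depends only on the class.** If `ψ`, `ψ'` are cohomologous continuous
cocycles of the local module, then `red(ψ(g)) = Õ` for all `g ∈ absInertia K_w` with `res g ∈ H'`
iff the same holds for `ψ'` (`ψ − ψ' = ∂Q` and `red(gQ − Q) = Õ` for inertial `g`).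
[cite: SilvermanAEC2009, VIII.§1, X.§4] -/
theorem forall_red_cocycle_eq_zero_iff_of_oneCocycleClass_eq
    (H' : Subgroup (absoluteGaloisGroup K))
    (ψ ψ' : contOneCocycles (DiscreteGaloisModule.toTopRep
      (GaloisRep.restrictField (wp.adicCompletion K) (V.torsionGaloisModule n))))
    (hψ : oneCocycleClass _ ψ = oneCocycleClass _ ψ') :
    (∀ g : absoluteGaloisGroup (wp.adicCompletion K), g ∈ absInertia (wp.adicCompletion K) →
        absGaloisRestrict K (wp.adicCompletion K) g ∈ H' →
        red (pointsMap V (wp.adicCompletion K) ((ψ.1 g : geomTorsion V n) : geomPoints V)) = 0) ↔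
      (∀ g : absoluteGaloisGroup (wp.adicCompletion K), g ∈ absInertia (wp.adicCompletion K) →
        absGaloisRestrict K (wp.adicCompletion K) g ∈ H' →
        red (pointsMap V (wp.adicCompletion K) ((ψ'.1 g : geomTorsion V n) : geomPoints V)) = 0) := by
  have h0 : oneCocycleClass _ (ψ - ψ') = 0 := by rw [oneCocycleClass_sub, hψ, sub_self]
  obtain ⟨Q, hQ⟩ := (oneCocycleClass_eq_zero_iff _ _).mp h0
  have key : ∀ g : absoluteGaloisGroup (wp.adicCompletion K), g ∈ absInertia (wp.adicCompletion K) →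
      red (pointsMap V (wp.adicCompletion K) ((ψ.1 g : geomTorsion V n) : geomPoints V)) =
        red (pointsMap V (wp.adicCompletion K) ((ψ'.1 g : geomTorsion V n) : geomPoints V)) := by
    intro g hg
    have h1 : ψ.1 g = ψ'.1 g + (ψ - ψ').1 g := by
      change ψ.1 g = ψ'.1 g + (ψ.1 - ψ'.1) g
      rw [ContinuousMap.sub_apply, add_sub_cancel]
    rw [h1, hQ g, AddSubgroup.coe_add, map_add, map_add, AddSubgroup.coe_sub, map_sub,
      pointsMap_rho_apply, red_smul_sub_self_of_mem_absInertia V wp hw hMK hred hg, add_zero]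
  refine ⟨fun H g hg hg' ↦ ?_, fun H g hg hg' ↦ ?_⟩
  · rw [← key g hg]; exact H g hg hg'
  · rw [key g hg]; exact H g hg hg'

/-! ## §3. Kummer classes are strict on the whole inertia group -/

include hw hred in
/-- **KUMMER CLASSES ARE STRICT (`𝓚 ≤ 𝓛`).** If the class of the continuous cocycle `ψ` lies in the
local Kummer condition `𝓚_w = ker(H¹(K_w, E[n]) → H¹(K_w, E(\bar K_w)))`, then `red(ψ(g)) = Õ` for
every `g` in the inertia group: `ψ(g) = gR − R` for some `R ∈ E(\bar K_w)` and inertia does not move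
reductions. [cite: SilvermanAEC2009, X.§4 (the local Kummer sequence), VIII.§1]
[cite: GreenbergLNM1716, §2 pp. 70–75] -/
theorem forall_red_cocycle_eq_zero_of_mem_kummerLocalConditionAt
    (ψ : contOneCocycles (DiscreteGaloisModule.toTopRep
      (GaloisRep.restrictField (wp.adicCompletion K) (V.torsionGaloisModule n))))
    (hψ : oneCocycleClass _ ψ ∈ V.kummerLocalConditionAt n (wp.adicCompletion K))
    {g : absoluteGaloisGroup (wp.adicCompletion K)} (hg : g ∈ absInertia (wp.adicCompletion K)) :
    red (pointsMap V (wp.adicCompletion K) ((ψ.1 g : geomTorsion V n) : geomPoints V)) = 0 := by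
  have h1 : galoisCohomology.map (V.torsionPointsMapIntertwining n (wp.adicCompletion K)) 1
      (oneCocycleClass _ ψ) = 0 := hψ
  rw [map_torsionPointsMapIntertwining_oneCocycleClass] at h1
  obtain ⟨R, hR⟩ := (oneCocycleClass_eq_zero_iff _ _).mp h1
  have hR' : ∀ σ : absoluteGaloisGroup (wp.adicCompletion K),
      pointsMap V (wp.adicCompletion K) ((ψ.1 σ : geomTorsion V n) : geomPoints V) = σ • R - R := hR
  rw [hR' g]
  exact red_smul_sub_self_of_mem_absInertia V wp hw hMK hred hg R

end Summit.BirchSwinnertonDyer.Rank1Residual.X1.LocalReductionStrict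

end
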